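import Mathlib.Probability.Kernel.MeasurableIntegral
import Mathlib.Analysis.Normed.Group.Bounded
import Literature.Probability.Percolation.FlipFairKernel

/-!
# Measurability and integrability of the Campbell integrands of an admissible kernel

Route `Summits/CriticalPhenomena/CardyFormulaZ2/Theses/CardyMeckeFlip`, crux `MeckeRigidity`
(item stmt-CriticalPhenomena-14826), line `registered`, stub `stub_crossingUniqueness` (helpers).

Clause (F) of the crux is an identity between Bochner integrals
`∫ S, ∫ x, φ x * g {i | Qᵢ ∈ S} ∂(M ε S) ∂P = ∫ S, ∫ x, φ x * g(toggled pattern) ∂(M ε S) ∂P`, and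
every manipulation of it (adding densities, splitting test functions, dominated convergence)
needs the outer integrands to be honest `L¹(P)` functions.  This file supplies that bookkeeping from
the first three conjuncts of (ADM) (`IsAdmissibleKernel`: each `M ε` a measurable kernel, locally
`P`-integrable):

* `measurable_comp_quadPattern` — any function of the crossing pattern `{i | Qᵢ ∈ S}` of a
  finite family of quads is measurable in `S`;
* `stronglyMeasurable_kernel_integral` — `S ↦ ∫ f ∂(K S)` is strongly measurable for a measurable
  kernel `K` and strongly measurable `f` (Mathlib's `StronglyMeasurable.integral_kernel`);
* `ae_kernel_closedBall_lt_top` — a.s. every cutoff kernel is locally finite;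
* `norm_integral_le_of_eq_zero_off` — `‖∫ f ∂μ‖ ≤ C · μ(K)` for `f` vanishing off `K`, `‖f‖ ≤ C`;
* `integrable_of_norm_le_kernel_closedBall` — an a.e.-strongly-measurable function of `S` dominated
  by `C · M ε S (B̄(0,r))` is `P`-integrable;
* `integrable_patternIntegrand` — the left-hand integrand of (F) is in `L¹(P)`
  (registered sub-goal `integrable_flipFairIntegrand_left` of the item, `∀`-form at the end).
-/

noncomputable section

open MeasureTheory Set Metric Filter Topology ProbabilityTheory
open scoped ENNReal NNReal
open Literature.Probability.Percolation Literature.Probability.Percolation.QuadCrossing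

namespace Summit.CriticalPhenomena.CardyFormulaZ2.Theorems.CardyMeckeFlip

variable {D : Set ℂ}

/-! ### Crossing patterns and kernel integrals are measurable in the configuration -/

/-- **Functions of a crossing pattern are measurable**: for a finite family of quads `Q` and any
`g`, `S ↦ g {i | Qᵢ ∈ S}` is measurable (finitely many measurable fibres). [folklore] -/
theorem measurable_comp_quadPattern {β : Type*} [MeasurableSpace β] {n : ℕ}
    (Q : Fin n → Quad D) (g : Set (Fin n) → β) :
    Measurable fun S : QuadConfig D => g {i | Q i ∈ S} := by
  have hfib : ∀ A : Set (Fin n), MeasurableSet {S : QuadConfig D | {i | Q i ∈ S} = A} := by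
    intro A
    have hA : {S : QuadConfig D | {i | Q i ∈ S} = A} = ⋂ i, {S | Q i ∈ S ↔ i ∈ A} := by
      ext S
      simp only [mem_setOf_eq, mem_iInter, Set.ext_iff]
    rw [hA]
    refine MeasurableSet.iInter fun i => ?_
    by_cases hi : i ∈ A
    · simp only [hi, iff_true]
      exact QuadConfig.measurableSet_crossedEvent (Q i)
    · simp only [hi, iff_false]
      exact (QuadConfig.measurableSet_crossedEvent (Q i)).compl
  intro t _
  have ht : (fun S : QuadConfig D => g {i | Q i ∈ S}) ⁻¹' t =
      ⋃ A ∈ {A : Set (Fin n) | g A ∈ t}, {S : QuadConfig D | {i | Q i ∈ S} = A} := by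
    ext S
    simp only [mem_preimage, mem_iUnion, mem_setOf_eq, exists_prop, exists_eq_right']
  rw [ht]
  exact MeasurableSet.biUnion (Set.to_countable _) fun A _ => hfib A

/-- **Kernel integrals are measurable in the configuration**: for a measurable kernel
`K : ℋ_D → Measure ℂ` and a strongly measurable `f`, `S ↦ ∫ f ∂(K S)` is strongly measurable (no
finiteness of the kernel is needed). [folklore] -/
theorem stronglyMeasurable_kernel_integral {K : QuadConfig D → Measure ℂ} (hK : Measurable K)
    {f : ℂ → ℝ} (hf : StronglyMeasurable f) :
    StronglyMeasurable fun S => ∫ x, f x ∂(K S) :=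
  hf.integral_kernel (κ := ⟨K, hK⟩)

/-- The left-hand integrand of (F), `S ↦ ∫ φ(x) g({i | Qᵢ ∈ S}) K(S)(dx) = g(pattern) · ∫ φ ∂(K S)`,
is strongly measurable. [folklore] -/
theorem stronglyMeasurable_patternIntegrand {K : QuadConfig D → Measure ℂ} (hK : Measurable K)
    {n : ℕ} (Q : Fin n → Quad D) (g : Set (Fin n) → ℝ) {φ : ℂ → ℝ} (hφ : Continuous φ) :
    StronglyMeasurable fun S => ∫ x, φ x * g {i | Q i ∈ S} ∂(K S) := by
  have h1 : (fun S => ∫ x, φ x * g {i | Q i ∈ S} ∂(K S)) =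
      fun S => (∫ x, φ x ∂(K S)) * g {i | Q i ∈ S} := by
    funext S
    exact integral_mul_const _ _
  rw [h1]
  exact (stronglyMeasurable_kernel_integral hK hφ.stronglyMeasurable).mul
    (measurable_comp_quadPattern Q g).stronglyMeasurable

/-! ### Local finiteness and the basic norm bound -/

/-- **A.s. local finiteness of an admissible kernel**: for `ε > 0`, `P`-a.s. every closed ball
has finite `M ε S`-mass. [folklore] -/
theorem ae_kernel_closedBall_lt_top {P : Measure (QuadConfig D)}
    {M : ℝ → QuadConfig D → Measure ℂ} (hADM : IsAdmissibleKernel P M) {ε : ℝ} (hε : 0 < ε) :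
    ∀ᵐ S ∂P, ∀ r : ℕ, M ε S (closedBall 0 r) < ∞ := by
  rw [ae_all_iff]
  intro r
  have hmeas : Measurable fun S => M ε S (closedBall 0 r) :=
    (Measure.measurable_measure.1 (hADM.measurable ε)) _ measurableSet_closedBall
  exact ae_lt_top hmeas (hADM.lintegral_closedBall_lt_top ε hε r).ne

/-- Every compactly supported function vanishes off some closed ball `B̄(0, r)`, `r ∈ ℕ`.
[folklore] -/
theorem exists_nat_eq_zero_off_closedBall {φ : ℂ → ℝ} (hφc : HasCompactSupport φ) :
    ∃ r : ℕ, ∀ x, x ∉ closedBall (0 : ℂ) r → φ x = 0 := by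
  obtain ⟨r₀, hr₀⟩ := hφc.isCompact.isBounded.subset_closedBall (0 : ℂ)
  refine ⟨⌈r₀⌉₊, fun x hx => image_eq_zero_of_notMem_tsupport fun hxs => hx ?_⟩
  exact closedBall_subset_closedBall (Nat.le_ceil r₀) (hr₀ hxs)

/-- **Norm bound for functions vanishing off a set of finite mass**: if `f = 0` off `K`,
`‖f‖ ≤ C` on `K` and `μ K < ∞`, then `‖∫ f ∂μ‖ ≤ C · μ.real K` (no measurability needed).
[folklore] -/
theorem norm_integral_le_of_eq_zero_off {μ : Measure ℂ} {f : ℂ → ℝ} {K : Set ℂ} {C : ℝ}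
    (hK : μ K < ∞) (hoff : ∀ x, x ∉ K → f x = 0) (hC : ∀ x ∈ K, ‖f x‖ ≤ C) :
    ‖∫ x, f x ∂μ‖ ≤ C * μ.real K := by
  rw [← setIntegral_eq_integral_of_forall_compl_eq_zero hoff]
  exact norm_setIntegral_le_of_norm_le_const hK hC

/-- **Integrability of the local mass**: `S ↦ (M ε S (B̄(0,r))).toReal` is `P`-integrable.
[folklore] -/
theorem integrable_toReal_kernel_closedBall {P : Measure (QuadConfig D)}
    {M : ℝ → QuadConfig D → Measure ℂ} (hADM : IsAdmissibleKernel P M) {ε : ℝ} (hε : 0 < ε)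
    (r : ℝ) : Integrable (fun S => (M ε S (closedBall 0 r)).toReal) P := by
  have hmeas : Measurable fun S => M ε S (closedBall 0 r) :=
    (Measure.measurable_measure.1 (hADM.measurable ε)) _ measurableSet_closedBall
  exact integrable_toReal_of_lintegral_ne_top hmeas.aemeasurable
    (hADM.lintegral_closedBall_lt_top ε hε r).ne

/-- **Domination by the local mass gives integrability**: an a.e.-strongly-measurable `F` with
`‖F S‖ ≤ C · M ε S (B̄(0,r))` a.s. is `P`-integrable. [folklore] -/
theorem integrable_of_norm_le_kernel_closedBall {P : Measure (QuadConfig D)}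
    {M : ℝ → QuadConfig D → Measure ℂ} (hADM : IsAdmissibleKernel P M) {ε : ℝ} (hε : 0 < ε)
    {F : QuadConfig D → ℝ} (hF : AEStronglyMeasurable F P) (C r : ℝ)
    (hle : ∀ᵐ S ∂P, ‖F S‖ ≤ C * (M ε S (closedBall 0 r)).toReal) : Integrable F P :=
  Integrable.mono' ((integrable_toReal_kernel_closedBall hADM hε r).const_mul C) hF hle

/-! ### The pattern integrands of (F) are in `L¹(P)` -/

/-- A function on the (finite) set of crossing patterns is bounded. [folklore] -/
theorem exists_forall_abs_le_of_pattern {n : ℕ} (g : Set (Fin n) → ℝ) : ∃ C : ℝ, 0 ≤ C ∧ ∀ A, |g A| ≤ C := by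
  obtain ⟨C, hC⟩ := (Set.finite_range fun A => |g A|).bddAbove
  refine ⟨max C 0, le_max_right _ _, fun A => (hC ⟨A, rfl⟩).trans (le_max_left _ _)⟩

/-- **Pointwise bound for a toggled-or-not pattern integrand**: for ANY pattern-valued map
`T : ℂ → Set (Fin n)` (the crossing pattern, or the toggled one), if `φ = 0` off `K`, `|φ| ≤ Cφ`,
`|g| ≤ Cg` and `μ K < ∞`, then `‖∫ φ(x) g(T x) ∂μ‖ ≤ Cg · Cφ · μ.real K`. [folklore] -/
theorem norm_integral_mul_pattern_le {μ : Measure ℂ} {φ : ℂ → ℝ} {K : Set ℂ} {Cφ Cg : ℝ}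
    (hK : μ K < ∞) (hoff : ∀ x, x ∉ K → φ x = 0) (hCφ : ∀ x, |φ x| ≤ Cφ) {n : ℕ}
    {g : Set (Fin n) → ℝ} (hCg : ∀ A, |g A| ≤ Cg) (T : ℂ → Set (Fin n)) :
    ‖∫ x, φ x * g (T x) ∂μ‖ ≤ Cg * Cφ * μ.real K := by
  have hCg0 : 0 ≤ Cg := (abs_nonneg _).trans (hCg ∅)
  refine norm_integral_le_of_eq_zero_off hK (fun x hx => by rw [hoff x hx, zero_mul]) ?_
  intro x _
  rw [Real.norm_eq_abs, abs_mul, mul_comm]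
  exact mul_le_mul (hCg _) (hCφ x) (abs_nonneg _) hCg0

/-- **The left-hand integrand of (F) is in `L¹(P)`** under (ADM): for `ε > 0`, a finite family
`Q`, any `g` and `φ ∈ C_c(ℂ)`, `S ↦ ∫ φ(x) g({i | Qᵢ ∈ S}) M ε S(dx)` is `P`-integrable.
[folklore] -/
theorem integrable_patternIntegrand {P : Measure (QuadConfig D)}
    {M : ℝ → QuadConfig D → Measure ℂ} (hADM : IsAdmissibleKernel P M) {ε : ℝ} (hε : 0 < ε)
    {n : ℕ} (Q : Fin n → Quad D) (g : Set (Fin n) → ℝ) {φ : ℂ → ℝ} (hφ : Continuous φ)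
    (hφc : HasCompactSupport φ) :
    Integrable (fun S => ∫ x, φ x * g {i | Q i ∈ S} ∂(M ε S)) P := by
  obtain ⟨r, hr⟩ := exists_nat_eq_zero_off_closedBall hφc
  obtain ⟨Cφ, hCφ⟩ := hφ.bounded_above_of_compact_support hφc
  obtain ⟨Cg, -, hCg⟩ := exists_forall_abs_le_of_pattern g
  refine integrable_of_norm_le_kernel_closedBall hADM hε
    (stronglyMeasurable_patternIntegrand (hADM.measurable ε) Q g hφ).aestronglyMeasurable
    (Cg * Cφ) r ?_
  filter_upwards [ae_kernel_closedBall_lt_top hADM hε] with S hS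
  exact norm_integral_mul_pattern_le (hS r) hr (fun x => (Real.norm_eq_abs _ ▸ hCφ x)) hCg
    (fun _ => {i | Q i ∈ S})

/-- **A.e. bound for the toggled (right-hand) integrand of (F)**: whatever the toggling map, the
integrand is a.s. dominated by the local mass — so it is in `L¹(P)` as soon as it is a.e. strongly
measurable (`integrable_of_norm_le_kernel_closedBall`). [folklore] -/
theorem ae_norm_toggledIntegrand_le {P : Measure (QuadConfig D)}
    {M : ℝ → QuadConfig D → Measure ℂ} (hADM : IsAdmissibleKernel P M) {ε : ℝ} (hε : 0 < ε)
    {n : ℕ} (g : Set (Fin n) → ℝ) {φ : ℂ → ℝ} (hφ : Continuous φ) (hφc : HasCompactSupport φ)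
    (T : QuadConfig D → ℂ → Set (Fin n)) :
    ∃ (C : ℝ) (r : ℕ), ∀ᵐ S ∂P, ‖∫ x, φ x * g (T S x) ∂(M ε S)‖ ≤ C * (M ε S (closedBall 0 r)).toReal := by
  obtain ⟨r, hr⟩ := exists_nat_eq_zero_off_closedBall hφc
  obtain ⟨Cφ, hCφ⟩ := hφ.bounded_above_of_compact_support hφc
  obtain ⟨Cg, -, hCg⟩ := exists_forall_abs_le_of_pattern g
  refine ⟨Cg * Cφ, r, ?_⟩
  filter_upwards [ae_kernel_closedBall_lt_top hADM hε] with S hS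
  exact norm_integral_mul_pattern_le (hS r) hr (fun x => (Real.norm_eq_abs _ ▸ hCφ x)) hCg (T S)

/-- **Registered form** (sub-goal `integrable_flipFairIntegrand_left` of item
stmt-CriticalPhenomena-14826): under `IsAdmissibleKernel P M` the left-hand integrand of the flip
identity (F) is `P`-integrable for every cutoff `ε > 0`, every finite family of quads, every pattern
function and every continuous compactly supported test function. [folklore] -/
theorem integrable_flipFairIntegrand_left : ∀ (D : Set ℂ) (P : Measure (QuadConfig D)) (M : ℝ → QuadConfig D → Measure ℂ), IsAdmissibleKernel P M → ∀ ε : ℝ, 0 < ε → ∀ (n : ℕ) (Q : Fin n → Quad D) (g : Set (Fin n) → ℝ) (φ : ℂ → ℝ), Continuous φ → HasCompactSupport φ → Integrable (fun S => ∫ x, φ x * g {i | Q i ∈ S} ∂(M ε S)) P := by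
  intro D P M hADM ε hε n Q g φ hφ hφc
  exact integrable_patternIntegrand hADM hε Q g hφ hφc

end Summit.CriticalPhenomena.CardyFormulaZ2.Theorems.CardyMeckeFlip

end
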